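import Summits.CriticalPhenomena.PercolationContinuityZ3.Theorems.SahiMasterFamilyPointwiseCoordinateGluingAbsorbing
import Summits.CriticalPhenomena.PercolationContinuityZ3.Theorems.SahiMasterFamilySandwich

/-!
# One-coordinate gluing, VI: the SANDWICHED APEX — `E_3(A, B, D)` when the `1`-minor is an ARBITRARY zero flag

Unit `prim-master-conj` (crux anchor stmt-CriticalPhenomena-4575, helper work), gen 18; memo
`run/shared/lean/prim/prim-l12/prim-master-conj/POINTWISE.md` §19.  Notation: `t = p_e`, `s = 1 − t`, `m = μ_p`, `X = A¹ = secAt e true A`, `Y = B¹`, `G = D¹`,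
`A⁰ = secAt e false A ⊆ X`, `B⁰ ⊆ Y`, `C = D⁰ ⊆ G`, `ν_A = m X − m A⁰` etc.

By the sandwich structure of `Z_3` (`…Sandwich`: `ZVia X Y G` forces `X ∩ G = X ∩ K`, `Y ∩ G = Y ∩ K`, `G ⊆ K` for an increasing `K` on which no
coordinate of `esupp X ∪ esupp Y` acts) EVERY zero-flag `1`-minor `(X, Y, G)` has the four product moments
  `m(X∩Y) = mX·mY`, `m(X∩G) = κ·mX`, `m(Y∩G) = κ·mY`, `m(X∩Y∩G) = κ·mX·mY`   (`κ = m K`; `κ = 1` is gen 15's absorbing shape, part V).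
THE IDENTITY (`sahiE_three_sandwichApex_eq`), for ARBITRARY `0`-sections and any real `κ` satisfying the four moment relations:
  `E_3(A,B,D) = (1−t)²·E_3(A⁰,B⁰,C) + t(1−t)·M + t(1−t)²·ν_A ν_B ν_C`,
  `M = Ẽ + (κ − mG)·(mX·ν_B + mY·ν_A)`,  `Ẽ = 2m(A⁰B⁰C) − mX·m(B⁰C) − mY·m(A⁰C) − mG·m(A⁰B⁰) + mX·mY·mG`
(`Ẽ` = Sahi's `E_3` formula for `(A⁰,B⁰,C)` with the three singleton moments replaced by those of the `1`-sections).  CONSEQUENCES: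
THE NINE-TERM CERTIFICATE (`sandwichApex_M_nonneg`, found by LP over 14,260 candidate atoms on 900 exact random configurations, all coefficients 1,
re-verified on 3,500 fresh ones):  with `N_A = X∖A⁰`, `N_B = Y∖B⁰`, `N_C = G∖C`,
  `M = Cov(K, A⁰∩B⁰) + Cov(X, B⁰∩C) + Cov(Y, A⁰∩C) + m(A⁰∩N_B∩N_C) + m(N_A∩B⁰∩N_C) + m(N_A∩N_B∩C) + m(N_A∩N_B∩N_C) + (mK − mG)·[Cov(A⁰,B⁰) + ν_Aν_B] ≥ 0`
(gen 15's part V is `K = univ`, where the first term vanishes and `mK − mG = 1 − mG`).  CONSEQUENCES: `sahiE_three_sandwichApex_ge` /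
**`sahiE_three_ge_sq_of_zVia`: if the `1`-minor of an increasing triple is a zero flag then `(1 − p_e)²·E_3(μ_p; U^{e←0}) ≤ E_3(μ_p; U)`** — the
one-face domination at order 3 (`1`-minor side) in FULL generality, exponent `2` sharp — and `sahiE_three_sandwichApex_nonneg` (`C_3` inherited
from the `0`-minor).  HONEST FRAMING: inheritance theorems; Kahn's Conjecture 5 / `MasterFamilyEqIff 3` remain OPEN. [this work]
-/

noncomputable section

open scoped Classical

namespace Summit.CriticalPhenomena.PercolationContinuityZ3.Theorems

open Finset Function
open Literature.Combinatorics.Sahi2008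
open Literature.Probability.Percolation (DeterminedBy)
open Literature.Probability.LatticeModels (prodBernoulli)
open Literature.Probability.LatticeModels.Kahn2022 (Affects real_inter_eq_mul_of_forall_not_affects)
open Literature.Probability.Percolation.DecisionTree (ind ind_of_mem ind_of_not_mem ind_nonneg)
open SahiCombDisjunct

namespace Pointwise

variable {ι : Type} [Fintype ι]

/-! ### 1. The identity under the four moment relations -/

section SandwichApex

variable (p : ι → unitInterval) (e : ι) (A B D : Set (Set ι)) (κ : ℝ)
  (h1 : ex (bernoulliWeight p) (ind (secAt e true A ∩ secAt e true B)) =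
    ex (bernoulliWeight p) (ind (secAt e true A)) * ex (bernoulliWeight p) (ind (secAt e true B)))
  (h2 : ex (bernoulliWeight p) (ind (secAt e true A ∩ secAt e true D)) = κ * ex (bernoulliWeight p) (ind (secAt e true A)))
  (h3 : ex (bernoulliWeight p) (ind (secAt e true B ∩ secAt e true D)) = κ * ex (bernoulliWeight p) (ind (secAt e true B)))
  (h4 : ex (bernoulliWeight p) (ind (secAt e true A ∩ secAt e true B ∩ secAt e true D)) =
    κ * ex (bernoulliWeight p) (ind (secAt e true A)) * ex (bernoulliWeight p) (ind (secAt e true B)))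
include h1 h2 h3 h4

/-- **Identity (VI), the sandwiched apex** (file header). [this work] -/
theorem sahiE_three_sandwichApex_eq :
    sahiE (bernoulliWeight p) 3 ![ind A, ind B, ind D] =
      (1 - (p e : ℝ)) ^ 2 * sahiE (bernoulliWeight p) 3 ![ind (secAt e false A), ind (secAt e false B), ind (secAt e false D)]
      + (p e : ℝ) * (1 - (p e : ℝ)) *
        ((2 * ex (bernoulliWeight p) (ind (secAt e false A ∩ secAt e false B ∩ secAt e false D))
            - ex (bernoulliWeight p) (ind (secAt e true A)) * ex (bernoulliWeight p) (ind (secAt e false B ∩ secAt e false D))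
            - ex (bernoulliWeight p) (ind (secAt e true B)) * ex (bernoulliWeight p) (ind (secAt e false A ∩ secAt e false D))
            - ex (bernoulliWeight p) (ind (secAt e true D)) * ex (bernoulliWeight p) (ind (secAt e false A ∩ secAt e false B))
            + ex (bernoulliWeight p) (ind (secAt e true A)) * ex (bernoulliWeight p) (ind (secAt e true B)) * ex (bernoulliWeight p) (ind (secAt e true D)))
          + (κ - ex (bernoulliWeight p) (ind (secAt e true D))) *
            (ex (bernoulliWeight p) (ind (secAt e true A)) *
                (ex (bernoulliWeight p) (ind (secAt e true B)) - ex (bernoulliWeight p) (ind (secAt e false B)))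
              + ex (bernoulliWeight p) (ind (secAt e true B)) *
                (ex (bernoulliWeight p) (ind (secAt e true A)) - ex (bernoulliWeight p) (ind (secAt e false A)))))
      + (p e : ℝ) * (1 - (p e : ℝ)) ^ 2 *
        ((ex (bernoulliWeight p) (ind (secAt e true A)) - ex (bernoulliWeight p) (ind (secAt e false A))) *
          (ex (bernoulliWeight p) (ind (secAt e true B)) - ex (bernoulliWeight p) (ind (secAt e false B))) *
          (ex (bernoulliWeight p) (ind (secAt e true D)) - ex (bernoulliWeight p) (ind (secAt e false D)))) := by
  have hAe := ex_ind_eq_secAt p e A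
  have hBe := ex_ind_eq_secAt p e B
  have hDe := ex_ind_eq_secAt p e D
  have hAB : ex (bernoulliWeight p) (ind (A ∩ B)) = (p e : ℝ) * ex (bernoulliWeight p) (ind (secAt e true A ∩ secAt e true B)) +
      (1 - (p e : ℝ)) * ex (bernoulliWeight p) (ind (secAt e false A ∩ secAt e false B)) := by
    rw [ex_ind_eq_secAt p e (A ∩ B), secAt_inter, secAt_inter]
  have hAD : ex (bernoulliWeight p) (ind (A ∩ D)) = (p e : ℝ) * ex (bernoulliWeight p) (ind (secAt e true A ∩ secAt e true D)) +
      (1 - (p e : ℝ)) * ex (bernoulliWeight p) (ind (secAt e false A ∩ secAt e false D)) := by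
    rw [ex_ind_eq_secAt p e (A ∩ D), secAt_inter, secAt_inter]
  have hBD : ex (bernoulliWeight p) (ind (B ∩ D)) = (p e : ℝ) * ex (bernoulliWeight p) (ind (secAt e true B ∩ secAt e true D)) +
      (1 - (p e : ℝ)) * ex (bernoulliWeight p) (ind (secAt e false B ∩ secAt e false D)) := by
    rw [ex_ind_eq_secAt p e (B ∩ D), secAt_inter, secAt_inter]
  have hABD : ex (bernoulliWeight p) (ind (A ∩ B ∩ D)) =
      (p e : ℝ) * ex (bernoulliWeight p) (ind (secAt e true A ∩ secAt e true B ∩ secAt e true D)) +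
      (1 - (p e : ℝ)) * ex (bernoulliWeight p) (ind (secAt e false A ∩ secAt e false B ∩ secAt e false D)) := by
    rw [ex_ind_eq_secAt p e (A ∩ B ∩ D), secAt_inter, secAt_inter, secAt_inter, secAt_inter]
  rw [sahiE_three, sahiE_three]
  simp only [ind_mul_ind_eq_inter]
  rw [hAe, hBe, hDe, hAB, hAD, hBD, hABD, h1, h2, h3, h4]
  ring

variable (hAu : IsUpperSet A) (hBu : IsUpperSet B) (hDu : IsUpperSet D)
include hAu hBu hDu

/-- **One-face domination at order 3 with exponent 2, reduced to `M ≥ 0`**: under the four sandwich moment relations, if the middle term `M`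
of the identity is `≥ 0` then `(1 − p_e)²·E_3(μ_p; A⁰, B⁰, C) ≤ E_3(μ_p; A, B, D)`. [this work] -/
theorem sahiE_three_sandwichApex_ge_of_M_nonneg
    (hM : 0 ≤ (2 * ex (bernoulliWeight p) (ind (secAt e false A ∩ secAt e false B ∩ secAt e false D))
            - ex (bernoulliWeight p) (ind (secAt e true A)) * ex (bernoulliWeight p) (ind (secAt e false B ∩ secAt e false D))
            - ex (bernoulliWeight p) (ind (secAt e true B)) * ex (bernoulliWeight p) (ind (secAt e false A ∩ secAt e false D))
            - ex (bernoulliWeight p) (ind (secAt e true D)) * ex (bernoulliWeight p) (ind (secAt e false A ∩ secAt e false B))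
            + ex (bernoulliWeight p) (ind (secAt e true A)) * ex (bernoulliWeight p) (ind (secAt e true B)) * ex (bernoulliWeight p) (ind (secAt e true D)))
          + (κ - ex (bernoulliWeight p) (ind (secAt e true D))) *
            (ex (bernoulliWeight p) (ind (secAt e true A)) *
                (ex (bernoulliWeight p) (ind (secAt e true B)) - ex (bernoulliWeight p) (ind (secAt e false B)))
              + ex (bernoulliWeight p) (ind (secAt e true B)) *
                (ex (bernoulliWeight p) (ind (secAt e true A)) - ex (bernoulliWeight p) (ind (secAt e false A))))) :
    (1 - (p e : ℝ)) ^ 2 * sahiE (bernoulliWeight p) 3 ![ind (secAt e false A), ind (secAt e false B), ind (secAt e false D)]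
      ≤ sahiE (bernoulliWeight p) 3 ![ind A, ind B, ind D] := by
  rw [sahiE_three_sandwichApex_eq p e A B D κ h1 h2 h3 h4]
  have ht0 : 0 ≤ (p e : ℝ) := (p e).2.1
  have ht1 : 0 ≤ 1 - (p e : ℝ) := sub_nonneg.2 (p e).2.2
  have nA := ex_secAt_true_sub_false_nonneg p e hAu
  have nB := ex_secAt_true_sub_false_nonneg p e hBu
  have nD := ex_secAt_true_sub_false_nonneg p e hDu
  have t1 := mul_nonneg (mul_nonneg ht0 ht1) hM
  have t2 := mul_nonneg (mul_nonneg ht0 (pow_nonneg ht1 2)) (mul_nonneg (mul_nonneg nA nB) nD)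
  linarith

end SandwichApex

/-! ### 2. The four moment relations from `ZVia` (the tree's sandwich lemma) -/

section Moments

variable (p : ι → unitInterval) {X Y G : Set (Set ι)} (hX : IsUpperSet X) (hY : IsUpperSet Y) (hG : IsUpperSet G)
  (hXne : X.Nonempty) (hYne : Y.Nonempty) (hZ : ZVia X Y G)
include hX hY hG hXne hYne hZ

/-- **The sandwich moments of a zero-flag triple**: for `ZVia X Y G` (increasing, `X, Y` nonempty) and the forced-open hull
`K = {ω | ω ∪ (esupp X ∪ esupp Y) ∈ G}`:  `m(X∩Y) = mX·mY`, `m(X∩G) = mK·mX`, `m(Y∩G) = mK·mY`, `m(X∩Y∩G) = mK·mX·mY`, and `G ⊆ K`.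
(FourStep's bookkeeping, restated for `ex (bernoulliWeight p) (ind ·)`.) [this work] -/
theorem sandwich_moments_of_zVia :
    ex (bernoulliWeight p) (ind (X ∩ Y)) = ex (bernoulliWeight p) (ind X) * ex (bernoulliWeight p) (ind Y) ∧
    ex (bernoulliWeight p) (ind (X ∩ G)) =
      ex (bernoulliWeight p) (ind {ω : Set ι | ω ∪ ↑(esupp X ∪ esupp Y) ∈ G}) * ex (bernoulliWeight p) (ind X) ∧
    ex (bernoulliWeight p) (ind (Y ∩ G)) =
      ex (bernoulliWeight p) (ind {ω : Set ι | ω ∪ ↑(esupp X ∪ esupp Y) ∈ G}) * ex (bernoulliWeight p) (ind Y) ∧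
    ex (bernoulliWeight p) (ind (X ∩ Y ∩ G)) =
      ex (bernoulliWeight p) (ind {ω : Set ι | ω ∪ ↑(esupp X ∪ esupp Y) ∈ G}) * ex (bernoulliWeight p) (ind X) *
        ex (bernoulliWeight p) (ind Y) ∧
    G ⊆ {ω : Set ι | ω ∪ ↑(esupp X ∪ esupp Y) ∈ G} := by
  set K : Set (Set ι) := {ω : Set ι | ω ∪ ↑(esupp X ∪ esupp Y) ∈ G} with hK
  have hXG : X ∩ G = X ∩ K := sandwich_left hX hY hG hYne hZ
  have hYG : Y ∩ G = Y ∩ K := sandwich_right hX hY hG hXne hZ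
  have hKu : IsUpperSet K := isUpperSet_forcedHull hG _
  have hXYG : X ∩ Y ∩ G = (X ∩ Y) ∩ K := by
    rw [Set.inter_assoc, hYG, ← Set.inter_assoc]
  have dXY : Disjoint (esupp X) (esupp Y) := (suppZeroFlag_two_iff hX hY).1 hZ.1
  have iXY : (prodBernoulli p).real (X ∩ Y) = (prodBernoulli p).real X * (prodBernoulli p).real Y :=
    real_inter_eq_mul_of_forall_not_affects p hX hY fun i hiX hiY =>
      Finset.disjoint_left.1 dXY (mem_esupp.2 hiX) (mem_esupp.2 hiY)
  have iXK : (prodBernoulli p).real (X ∩ K) = (prodBernoulli p).real X * (prodBernoulli p).real K :=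
    real_inter_eq_mul_of_forall_not_affects p hX hKu (forall_not_affects_forcedHull_left X Y G)
  have iYK : (prodBernoulli p).real (Y ∩ K) = (prodBernoulli p).real Y * (prodBernoulli p).real K :=
    real_inter_eq_mul_of_forall_not_affects p hY hKu (forall_not_affects_forcedHull_right X Y G)
  have iXYK : (prodBernoulli p).real ((X ∩ Y) ∩ K) =
      (prodBernoulli p).real X * (prodBernoulli p).real Y * (prodBernoulli p).real K := by
    rw [real_inter_eq_mul_of_forall_not_affects p (hX.inter hY) hKu (forall_not_affects_forcedHull_inter X Y G), iXY]
  simp only [ex_bernoulliWeight_ind]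
  refine ⟨iXY, ?_, ?_, ?_, subset_forcedHull hG _⟩
  · rw [hXG, iXK, mul_comm]
  · rw [hYG, iYK, mul_comm]
  · rw [hXYG, iXYK]; ring

end Moments

/-! ### 3. The identity and the reduction for a zero-flag `1`-minor -/

section ZeroFlagOne

variable (p : ι → unitInterval) (e : ι) (A B D : Set (Set ι)) (hAu : IsUpperSet A) (hBu : IsUpperSet B) (hDu : IsUpperSet D)
  (hAne : (secAt e true A).Nonempty) (hBne : (secAt e true B).Nonempty)
  (hZ : ZVia (secAt e true A) (secAt e true B) (secAt e true D))
include hAu hBu hDu hAne hBne hZ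

/-- **One-face domination at order 3, `1`-minor side, reduced to `M ≥ 0`**: if the `1`-minor `(A¹, B¹, D¹)` of an increasing triple is
a zero flag via `(A¹, B¹)` (`A¹, B¹` nonempty) and the middle term `M` of `sahiE_three_sandwichApex_eq` (with `κ = m K`, `K` the forced-open hull
of `D¹` over `esupp A¹ ∪ esupp B¹`) is `≥ 0`, then `(1 − p_e)²·E_3(μ_p; A⁰, B⁰, D⁰) ≤ E_3(μ_p; A, B, D)`. [this work] -/
theorem sahiE_three_ge_sq_of_zVia_of_M_nonneg
    (hM : 0 ≤ (2 * ex (bernoulliWeight p) (ind (secAt e false A ∩ secAt e false B ∩ secAt e false D))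
            - ex (bernoulliWeight p) (ind (secAt e true A)) * ex (bernoulliWeight p) (ind (secAt e false B ∩ secAt e false D))
            - ex (bernoulliWeight p) (ind (secAt e true B)) * ex (bernoulliWeight p) (ind (secAt e false A ∩ secAt e false D))
            - ex (bernoulliWeight p) (ind (secAt e true D)) * ex (bernoulliWeight p) (ind (secAt e false A ∩ secAt e false B))
            + ex (bernoulliWeight p) (ind (secAt e true A)) * ex (bernoulliWeight p) (ind (secAt e true B)) * ex (bernoulliWeight p) (ind (secAt e true D)))
          + (ex (bernoulliWeight p) (ind {ω : Set ι | ω ∪ ↑(esupp (secAt e true A) ∪ esupp (secAt e true B)) ∈ secAt e true D})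
              - ex (bernoulliWeight p) (ind (secAt e true D))) *
            (ex (bernoulliWeight p) (ind (secAt e true A)) *
                (ex (bernoulliWeight p) (ind (secAt e true B)) - ex (bernoulliWeight p) (ind (secAt e false B)))
              + ex (bernoulliWeight p) (ind (secAt e true B)) *
                (ex (bernoulliWeight p) (ind (secAt e true A)) - ex (bernoulliWeight p) (ind (secAt e false A))))) :
    (1 - (p e : ℝ)) ^ 2 * sahiE (bernoulliWeight p) 3 ![ind (secAt e false A), ind (secAt e false B), ind (secAt e false D)]
      ≤ sahiE (bernoulliWeight p) 3 ![ind A, ind B, ind D] := by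
  obtain ⟨h1, h2, h3, h4, -⟩ := sandwich_moments_of_zVia p (isUpperSet_secAt e true hAu) (isUpperSet_secAt e true hBu)
    (isUpperSet_secAt e true hDu) hAne hBne hZ
  exact sahiE_three_sandwichApex_ge_of_M_nonneg p e A B D _ h1 h2 h3 h4 hAu hBu hDu hM

end ZeroFlagOne

/-! ### 4. Positivity of the middle term: the nine-term certificate (general `K`) -/

section Cells

variable (μ : Set ι → ℝ)

/-- `m(P ∩ (Y∖B) ∩ (G∖C)) = m(PYG) − m(PYC) − m(PBG) + m(PBC)` for `B ⊆ Y`, `C ⊆ G`. [folklore] -/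
theorem cell_inter_sdiff_sdiff (P : Set (Set ι)) {B Y : Set (Set ι)} (hBY : B ⊆ Y) {C G : Set (Set ι)} (hCG : C ⊆ G) :
    ex μ (ind (P ∩ (Y \ B) ∩ (G \ C))) = ex μ (ind (P ∩ Y ∩ G)) - ex μ (ind (P ∩ Y ∩ C)) - ex μ (ind (P ∩ B ∩ G)) + ex μ (ind (P ∩ B ∩ C)) := by
  have h : ind (P ∩ (Y \ B) ∩ (G \ C)) = ind (P ∩ Y ∩ G) - ind (P ∩ Y ∩ C) - ind (P ∩ B ∩ G) + ind (P ∩ B ∩ C) := by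
    funext ω
    simp only [Pi.add_apply, Pi.sub_apply, Literature.Probability.Percolation.BHK2006.ind_inter, ind_sdiff_of_subset hBY, ind_sdiff_of_subset hCG]
    ring
  rw [h, ex_add, ex_sub', ex_sub']

/-- `m((X∖A) ∩ (Y∖B) ∩ (G∖C))` in inclusion–exclusion form, for `A ⊆ X`, `B ⊆ Y`, `C ⊆ G`. [folklore] -/
theorem cell_sdiff_sdiff_sdiff {A X : Set (Set ι)} (hAX : A ⊆ X) {B Y : Set (Set ι)} (hBY : B ⊆ Y) {C G : Set (Set ι)} (hCG : C ⊆ G) :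
    ex μ (ind ((X \ A) ∩ (Y \ B) ∩ (G \ C))) =
      ex μ (ind (X ∩ Y ∩ G)) - ex μ (ind (X ∩ Y ∩ C)) - ex μ (ind (X ∩ B ∩ G)) + ex μ (ind (X ∩ B ∩ C))
      - ex μ (ind (A ∩ Y ∩ G)) + ex μ (ind (A ∩ Y ∩ C)) + ex μ (ind (A ∩ B ∩ G)) - ex μ (ind (A ∩ B ∩ C)) := by
  have h : ind ((X \ A) ∩ (Y \ B) ∩ (G \ C)) =
      ind (X ∩ Y ∩ G) - ind (X ∩ Y ∩ C) - ind (X ∩ B ∩ G) + ind (X ∩ B ∩ C)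
      - ind (A ∩ Y ∩ G) + ind (A ∩ Y ∩ C) + ind (A ∩ B ∩ G) - ind (A ∩ B ∩ C) := by
    funext ω
    simp only [Pi.add_apply, Pi.sub_apply, Literature.Probability.Percolation.BHK2006.ind_inter, ind_sdiff_of_subset hAX,
      ind_sdiff_of_subset hBY, ind_sdiff_of_subset hCG]
    ring
  rw [h, ex_sub', ex_add, ex_add, ex_sub', ex_add, ex_sub', ex_sub']

end Cells

section Positivity

variable (p : ι → unitInterval) (e : ι) (A B D K : Set (Set ι))
  (hAu : IsUpperSet A) (hBu : IsUpperSet B) (hDu : IsUpperSet D) (hKu : IsUpperSet K)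
  (hGK : secAt e true D ⊆ K) (hXK : secAt e true A ∩ K ⊆ secAt e true D)
  (h4 : ex (bernoulliWeight p) (ind (secAt e true A ∩ secAt e true B ∩ secAt e true D)) =
    ex (bernoulliWeight p) (ind K) * ex (bernoulliWeight p) (ind (secAt e true A)) * ex (bernoulliWeight p) (ind (secAt e true B)))
include hAu hBu hDu hKu hGK hXK h4

/-- **THE NINE-TERM CERTIFICATE**: the middle term `M` of `sahiE_three_sandwichApex_eq` (with `κ = m K`) equals
`Cov(K, A⁰B⁰) + Cov(X, B⁰C) + Cov(Y, A⁰C) + m(A⁰∩N_B∩N_C) + m(N_A∩B⁰∩N_C) + m(N_A∩N_B∩C) + m(N_A∩N_B∩N_C) + (mK − mG)·[Cov(A⁰,B⁰) + ν_Aν_B]`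
(`N_A = X∖A⁰`, `N_B = Y∖B⁰`, `N_C = G∖C`; found by LP over 14,260 candidate atoms, all nine coefficients `1`), hence `M ≥ 0`: every term is a
Harris covariance of increasing events, a probability, or `(mK − mG) ≥ 0` times such.  `K = univ` is gen 15's part V. [this work] -/
theorem sandwichApex_M_nonneg :
    0 ≤ (2 * ex (bernoulliWeight p) (ind (secAt e false A ∩ secAt e false B ∩ secAt e false D))
            - ex (bernoulliWeight p) (ind (secAt e true A)) * ex (bernoulliWeight p) (ind (secAt e false B ∩ secAt e false D))
            - ex (bernoulliWeight p) (ind (secAt e true B)) * ex (bernoulliWeight p) (ind (secAt e false A ∩ secAt e false D))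
            - ex (bernoulliWeight p) (ind (secAt e true D)) * ex (bernoulliWeight p) (ind (secAt e false A ∩ secAt e false B))
            + ex (bernoulliWeight p) (ind (secAt e true A)) * ex (bernoulliWeight p) (ind (secAt e true B)) * ex (bernoulliWeight p) (ind (secAt e true D)))
          + (ex (bernoulliWeight p) (ind K) - ex (bernoulliWeight p) (ind (secAt e true D))) *
            (ex (bernoulliWeight p) (ind (secAt e true A)) *
                (ex (bernoulliWeight p) (ind (secAt e true B)) - ex (bernoulliWeight p) (ind (secAt e false B)))
              + ex (bernoulliWeight p) (ind (secAt e true B)) *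
                (ex (bernoulliWeight p) (ind (secAt e true A)) - ex (bernoulliWeight p) (ind (secAt e false A)))) := by
  -- notation
  set m := bernoulliWeight p with hm
  set X := secAt e true A; set Y := secAt e true B; set G := secAt e true D
  set A0 := secAt e false A; set B0 := secAt e false B; set C0 := secAt e false D
  have hA0u : IsUpperSet A0 := isUpperSet_secAt e false hAu
  have hB0u : IsUpperSet B0 := isUpperSet_secAt e false hBu
  have hC0u : IsUpperSet C0 := isUpperSet_secAt e false hDu
  have hXu : IsUpperSet X := isUpperSet_secAt e true hAu
  have hYu : IsUpperSet Y := isUpperSet_secAt e true hBu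
  have sA : A0 ⊆ X := RigidityAll.secAt_false_subset_secAt_true e hAu
  have sB : B0 ⊆ Y := RigidityAll.secAt_false_subset_secAt_true e hBu
  have sC : C0 ⊆ G := RigidityAll.secAt_false_subset_secAt_true e hDu
  -- the set identity behind the new Harris term: `K ∩ A⁰ ∩ B⁰ = G ∩ A⁰ ∩ B⁰`
  have hKAB : K ∩ (A0 ∩ B0) = G ∩ A0 ∩ B0 := by
    ext ω
    simp only [Set.mem_inter_iff]
    constructor
    · rintro ⟨hK, hA, hB⟩
      exact ⟨⟨hXK ⟨sA hA, hK⟩, hA⟩, hB⟩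
    · rintro ⟨⟨hG, hA⟩, hB⟩
      exact ⟨hGK hG, hA, hB⟩
  -- the nine atoms
  have t1 : 0 ≤ ex m (ind (G ∩ A0 ∩ B0)) - ex m (ind K) * ex m (ind (A0 ∩ B0)) := by
    rw [← hKAB]; exact cov_ind_nonneg p hKu (hA0u.inter hB0u)
  have t2 : 0 ≤ ex m (ind (X ∩ (B0 ∩ C0))) - ex m (ind X) * ex m (ind (B0 ∩ C0)) := cov_ind_nonneg p hXu (hB0u.inter hC0u)
  have t3 : 0 ≤ ex m (ind (Y ∩ (A0 ∩ C0))) - ex m (ind Y) * ex m (ind (A0 ∩ C0)) := cov_ind_nonneg p hYu (hA0u.inter hC0u)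
  have t4 : 0 ≤ ex m (ind (A0 ∩ Y ∩ G)) - ex m (ind (A0 ∩ Y ∩ C0)) - ex m (ind (A0 ∩ B0 ∩ G)) + ex m (ind (A0 ∩ B0 ∩ C0)) := by
    rw [← cell_inter_sdiff_sdiff m A0 sB sC]; exact ex_ind_nonneg' p _
  have t5 : 0 ≤ ex m (ind (B0 ∩ X ∩ G)) - ex m (ind (B0 ∩ X ∩ C0)) - ex m (ind (B0 ∩ A0 ∩ G)) + ex m (ind (B0 ∩ A0 ∩ C0)) := by
    rw [← cell_inter_sdiff_sdiff m B0 sA sC]; exact ex_ind_nonneg' p _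
  have t6 : 0 ≤ ex m (ind (C0 ∩ X ∩ Y)) - ex m (ind (C0 ∩ X ∩ B0)) - ex m (ind (C0 ∩ A0 ∩ Y)) + ex m (ind (C0 ∩ A0 ∩ B0)) := by
    rw [← cell_inter_sdiff_sdiff m C0 sA sB]; exact ex_ind_nonneg' p _
  have t7 : 0 ≤ ex m (ind (X ∩ Y ∩ G)) - ex m (ind (X ∩ Y ∩ C0)) - ex m (ind (X ∩ B0 ∩ G)) + ex m (ind (X ∩ B0 ∩ C0))
      - ex m (ind (A0 ∩ Y ∩ G)) + ex m (ind (A0 ∩ Y ∩ C0)) + ex m (ind (A0 ∩ B0 ∩ G)) - ex m (ind (A0 ∩ B0 ∩ C0)) := by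
    rw [← cell_sdiff_sdiff_sdiff m sA sB sC]; exact ex_ind_nonneg' p _
  have t8 : 0 ≤ ex m (ind K) - ex m (ind G) := by rw [ex_ind_sub_of_subset _ hGK]; exact ex_ind_nonneg' p _
  have t9 : 0 ≤ (ex m (ind (A0 ∩ B0)) - ex m (ind A0) * ex m (ind B0))
      + (ex m (ind X) - ex m (ind A0)) * (ex m (ind Y) - ex m (ind B0)) :=
    add_nonneg (cov_ind_nonneg p hA0u hB0u) (mul_nonneg (ex_secAt_true_sub_false_nonneg p e hAu) (ex_secAt_true_sub_false_nonneg p e hBu))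
  have t89 := mul_nonneg t8 t9
  -- bookkeeping: normalise the intersection orders appearing in the atoms
  have e1 : B0 ∩ X ∩ G = X ∩ B0 ∩ G := by ac_rfl
  have e2 : B0 ∩ X ∩ C0 = X ∩ B0 ∩ C0 := by ac_rfl
  have e3 : B0 ∩ A0 ∩ G = A0 ∩ B0 ∩ G := by ac_rfl
  have e4 : B0 ∩ A0 ∩ C0 = A0 ∩ B0 ∩ C0 := by ac_rfl
  have e5 : C0 ∩ X ∩ Y = X ∩ Y ∩ C0 := by ac_rfl
  have e6 : C0 ∩ X ∩ B0 = X ∩ B0 ∩ C0 := by ac_rfl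
  have e7 : C0 ∩ A0 ∩ Y = A0 ∩ Y ∩ C0 := by ac_rfl
  have e8 : C0 ∩ A0 ∩ B0 = A0 ∩ B0 ∩ C0 := by ac_rfl
  have e9 : X ∩ (B0 ∩ C0) = X ∩ B0 ∩ C0 := by ac_rfl
  have e10 : Y ∩ (A0 ∩ C0) = A0 ∩ Y ∩ C0 := by ac_rfl
  have e11 : G ∩ A0 ∩ B0 = A0 ∩ B0 ∩ G := by ac_rfl
  have e12 : A0 ∩ B0 ∩ C0 = secAt e false A ∩ secAt e false B ∩ secAt e false D := rfl
  rw [e1, e2, e3, e4] at t5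
  rw [e5, e6, e7, e8] at t6
  rw [e9] at t2
  rw [e10] at t3
  rw [e11] at t1
  have h4' : ex m (ind (X ∩ Y ∩ G)) = ex m (ind K) * ex m (ind X) * ex m (ind Y) := h4
  nlinarith [t1, t2, t3, t4, t5, t6, t7, t89, h4']

/-- **One-face domination at order 3 (`1`-minor side), general sandwich**: under the sandwich data
(`G ⊆ K`, `X ∩ K ⊆ G`, `K` increasing, the four moment relations with `κ = m K`),
`(1 − p_e)²·E_3(μ_p; A⁰, B⁰, C) ≤ E_3(μ_p; A, B, D)`. [this work] -/
theorem sahiE_three_sandwichApex_ge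
    (h1 : ex (bernoulliWeight p) (ind (secAt e true A ∩ secAt e true B)) =
      ex (bernoulliWeight p) (ind (secAt e true A)) * ex (bernoulliWeight p) (ind (secAt e true B)))
    (h2 : ex (bernoulliWeight p) (ind (secAt e true A ∩ secAt e true D)) = ex (bernoulliWeight p) (ind K) * ex (bernoulliWeight p) (ind (secAt e true A)))
    (h3 : ex (bernoulliWeight p) (ind (secAt e true B ∩ secAt e true D)) = ex (bernoulliWeight p) (ind K) * ex (bernoulliWeight p) (ind (secAt e true B))) :
    (1 - (p e : ℝ)) ^ 2 * sahiE (bernoulliWeight p) 3 ![ind (secAt e false A), ind (secAt e false B), ind (secAt e false D)]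
      ≤ sahiE (bernoulliWeight p) 3 ![ind A, ind B, ind D] :=
  sahiE_three_sandwichApex_ge_of_M_nonneg p e A B D _ h1 h2 h3 h4 hAu hBu hDu
    (sandwichApex_M_nonneg p e A B D K hAu hBu hDu hKu hGK hXK h4)

/-- **`C_3` is inherited from the `0`-minor** (general sandwich): `E_3(μ_p; A⁰, B⁰, C) ≥ 0 ⟹ E_3(μ_p; A, B, D) ≥ 0`. [this work] -/
theorem sahiE_three_sandwichApex_nonneg
    (h1 : ex (bernoulliWeight p) (ind (secAt e true A ∩ secAt e true B)) =
      ex (bernoulliWeight p) (ind (secAt e true A)) * ex (bernoulliWeight p) (ind (secAt e true B)))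
    (h2 : ex (bernoulliWeight p) (ind (secAt e true A ∩ secAt e true D)) = ex (bernoulliWeight p) (ind K) * ex (bernoulliWeight p) (ind (secAt e true A)))
    (h3 : ex (bernoulliWeight p) (ind (secAt e true B ∩ secAt e true D)) = ex (bernoulliWeight p) (ind K) * ex (bernoulliWeight p) (ind (secAt e true B)))
    (h0 : 0 ≤ sahiE (bernoulliWeight p) 3 ![ind (secAt e false A), ind (secAt e false B), ind (secAt e false D)]) :
    0 ≤ sahiE (bernoulliWeight p) 3 ![ind A, ind B, ind D] :=
  le_trans (mul_nonneg (pow_nonneg (sub_nonneg.2 (p e).2.2) 2) h0)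
    (sahiE_three_sandwichApex_ge p e A B D K hAu hBu hDu hKu hGK hXK h4 h1 h2 h3)

end Positivity

/-! ### 5. The unconditional theorems for a zero-flag `1`-minor (`ZVia`) -/

section ZeroFlagOneMain

variable (p : ι → unitInterval) (e : ι) (A B D : Set (Set ι)) (hAu : IsUpperSet A) (hBu : IsUpperSet B) (hDu : IsUpperSet D)
  (hAne : (secAt e true A).Nonempty) (hBne : (secAt e true B).Nonempty)
  (hZ : ZVia (secAt e true A) (secAt e true B) (secAt e true D))
include hAu hBu hDu hAne hBne hZ

/-- **ONE-FACE DOMINATION AT ORDER 3, `1`-MINOR SIDE, IN FULL GENERALITY**: if the `1`-minor `(A¹, B¹, D¹)` of an increasing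
triple `(A, B, D)` along the coordinate `e` is a zero flag via the pair `(A¹, B¹)` (`A¹, B¹` nonempty; nothing is assumed about the
`0`-sections), then `(1 − p_e)²·E_3(μ_p; A⁰, B⁰, D⁰) ≤ E_3(μ_p; A, B, D)` for every `p`.  (The exponent `2` is sharp: equality off `Z_3`
occurs in the OR class, memo §19.) [this work] -/
theorem sahiE_three_ge_sq_of_zVia :
    (1 - (p e : ℝ)) ^ 2 * sahiE (bernoulliWeight p) 3 ![ind (secAt e false A), ind (secAt e false B), ind (secAt e false D)]
      ≤ sahiE (bernoulliWeight p) 3 ![ind A, ind B, ind D] := by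
  obtain ⟨h1, h2, h3, h4, hGK⟩ := sandwich_moments_of_zVia p (isUpperSet_secAt e true hAu) (isUpperSet_secAt e true hBu)
    (isUpperSet_secAt e true hDu) hAne hBne hZ
  have hXK : secAt e true A ∩ {ω : Set ι | ω ∪ ↑(esupp (secAt e true A) ∪ esupp (secAt e true B)) ∈ secAt e true D} ⊆ secAt e true D := by
    rw [← sandwich_left (isUpperSet_secAt e true hAu) (isUpperSet_secAt e true hBu) (isUpperSet_secAt e true hDu) hBne hZ]
    exact Set.inter_subset_right
  exact sahiE_three_sandwichApex_ge p e A B D _ hAu hBu hDu (isUpperSet_forcedHull (isUpperSet_secAt e true hDu) _) hGK hXK h4 h1 h2 h3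

end ZeroFlagOneMain

end Pointwise

end Summit.CriticalPhenomena.PercolationContinuityZ3.Theorems

end
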